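import Mathlib
import Summits.Ventures.HodgeRepro.OcticCMPointSixCard
import Summits.Ventures.HodgeRepro.OcticCMPointS3ConjSymplectic

/-!
# OcticCMPointSixConjSymplectic — the conjugate-symplectic class at `𝔭 | 5`, conductor `6`: the sign is the Legendre symbol of the stationary point

Blind re-derivation cell `pub-hodge-repro`, seat night-2 (gen 5).  Target tree path
`lean/Summits/Ventures/HodgeRepro/OcticCMPointSixConjSymplectic.lean`.  The conductor-`6` row of
`OcticCMPointS3ConjSymplectic.lean`: on `R6 = 𝒪/𝔭⁶ = R8 ⧸ (5w²)` the residue `res₆ : R6 → 𝔽₅` descends from `res`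
(the constant coordinate mod `5` vanishes on `J`), `ConjSymplecticSix` transcribes `ρ|_{𝒪_k^×} = ω_{K_v/k_v}` as
`ρ(u) = χ_quad(res₆ u)` on the `σ₆`-fixed units (a DEFINITION, as gen 4's `ConjSymplecticTame`), and
**`eps_conjSymplectic_six`**: `ε(½, ρ, ψ̃₆) = ρ(ϖ)^n · χ_quad(res₆ a)` with `κ = 1/125` — `ω(ϖ)^n` times the Legendre
symbol of the stationary point's residue, at every even conductor `2, 4, 6, 8` of `𝔭 | 5` now; and `E3At_of_six` feeds the
conductor-`6` row into the chain's `E3At` by name.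

**What this is not.**  The class definition is a transcription of the norm-residue symbol, not a theorem about it.
Nothing here says anything about the status of the Hodge conjecture for CM abelian varieties, which is NOT proved.
-/

set_option autoImplicit false

noncomputable section

open Polynomial Classical

namespace Summit.Ventures.HodgeRepro.PeriodCloser

namespace SixModel

open GaussSumStability EightModel

/-- `res` vanishes on `J` (the `1`-coordinate of an element of `J` is `0`). -/
theorem res_eq_zero_of_mem_J {y : R8} (hy : y ∈ J) : res y = 0 := by
  unfold res
  rw [(coords_of_mem_J hy).1, map_zero]

/-- `res` is additive. -/
theorem res_add (y z : R8) : res (y + z) = res y + res z := by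
  unfold res
  rw [map_add, Finsupp.coe_add, Pi.add_apply, map_add]

/-- **The residue `res₆ : 𝒪/𝔭⁶ → 𝔽₅`**, descended from `res`. -/
def res6 : R6 →+ ZMod 5 :=
  QuotientAddGroup.lift J.toAddSubgroup
    { toFun := res
      map_zero' := by simp [res]
      map_add' := res_add }
    (fun y hy => res_eq_zero_of_mem_J hy)

/-- `res₆ (q y) = res y`. -/
theorem res6_q (y : R8) : res6 (q y) = res y := rfl

/-- **The conjugate-symplectic condition at conductor `6`**: on the `σ₆`-fixed units the character is the Legendre
symbol of the residue. -/
def ConjSymplecticSix (ρ : LocalChar R6) : Prop :=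
  ∀ u : R6ˣ, conj6 (u : R6) = u → ρ.unit (u : R6) = quadChar5C (res6 u)

/-- Elements congruent mod `I₆` have the same residue (`I₆ = q((w³))`, and `res (w³ y) = 0`). -/
theorem res6_eq_of_sub_mem {u v : R6} (h : u - v ∈ I6) : res6 u = res6 v := by
  obtain ⟨y, hy⟩ := (mem_I6_iff _).1 h
  have : res6 u = res6 v + res6 (u - v) := by rw [← map_add, add_sub_cancel]
  rw [this, hy, res6_q]
  have h0 : res (w ^ 3 * y) = 0 := by
    unfold res
    rw [eq_comb y, w_cube_mul_comb, coords_comb]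
    have : ∀ c : ZMod 25, c5 (20 * c) = 0 := by decide
    exact this _
  rw [h0, add_zero]

/-- The residue of a unit of `R6` is non-zero: lift to `R8` — `q a' ` a unit means `a'` is a unit (`J` is nilpotent:
`(5w²)² = 0`), and the residue of a unit of `R8` is non-zero. -/
theorem res6_ne_zero_of_isUnit (u : R6ˣ) : res6 u ≠ 0 := by
  obtain ⟨a', ha'⟩ := q_surjective (u : R6)
  obtain ⟨v, hv⟩ := u.isUnit.exists_right_inv
  obtain ⟨v', rfl⟩ := q_surjective v
  rw [← ha', ← map_mul] at hv
  have h1 : a' * v' - 1 ∈ J := by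
    rw [← Ideal.Quotient.eq, map_one]
    exact hv
  obtain ⟨b, hb⟩ := (mem_J_iff _).1 h1
  -- `a' v' = 1 + 5w² b`, and `(1 + 5w² b)(1 − 5w² b) = 1 − 25 w⁴ b² = 1`
  have hunit : IsUnit a' := by
    have h25 := twentyfive_eq_zero
    refine IsUnit.of_mul_eq_one (v' * (1 - 5 * w ^ 2 * b)) ?_
    linear_combination (1 - 5 * w ^ 2 * b) * hb - (w ^ 4 * b ^ 2) * h25
  rw [← ha', res6_q]
  exact res_ne_zero_of_isUnit hunit.unit

/-- **The conductor-`6` root number of a conjugate-symplectic character at `𝔭 | 5`**: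
`ε(½, ρ, ψ̃₆) = ρ(ϖ)^n · χ_quad(res₆ a)`, `a` the stationary point, `κ = 1/125`. -/
theorem eps_conjSymplectic_six (n : ℕ) (ρ : LocalChar R6) (hσ : ∀ x, ρ.unit (conj6 x) = ρ.unit⁻¹ x)
    (hcs : ConjSymplecticSix ρ) (a : R6ˣ) (hρ : LocalChar.Primitive psi6 I6 ρ a) :
    LocalChar.eps (1 / 125) n ρ psi6 = ρ.piVal ^ n * quadChar5C (res6 a) := by
  obtain ⟨a₀, hσa₀, hsub, -, heps⟩ := eps_six_half n ρ hσ a hρ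
  rw [heps, hcs a₀ hσa₀, ← res6_eq_of_sub_mem hsub, quadChar5C_inv _ (res6_ne_zero_of_isUnit a)]


open NumberField in
/-- **(E3) at a place of `S₃` of a face from the conductor-`6` model, by the chain's name**: if the face's four local
signs at `v` are the model's `ε(½, ρ_j, ψ̃₆)` (`κ = 1/125`) for conjugate-dual `ρ_j` of conductor exactly `6` trivial on
the `σ₆`-fixed units, with `π₀π₁ = π₂π₃`, then `E3At I v d` (`PeriodCloserC7Stability.E3At_of_complex`). -/
theorem E3At_of_six {L : Type} [Field L] [NumberField L] [IsCMField L] (I : C7Face L) (v : I.Place)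
    (d : I.Datum) (n : ℕ) (ρ : Fin 4 → LocalChar R6) (hσ : ∀ j x, (ρ j).unit (conj6 x) = (ρ j).unit⁻¹ x)
    (hfix : ∀ j (u : R6ˣ), conj6 (u : R6) = u → (ρ j).unit (u : R6) = 1) (a : Fin 4 → R6ˣ)
    (hρ : ∀ j, LocalChar.Primitive psi6 I6 (ρ j) (a j))
    (hN2 : (ρ 0).piVal * (ρ 1).piVal = (ρ 2).piVal * (ρ 3).piVal)
    (he : ∀ j, ((I.localRootNumber v (I.chars d j) : ℤ) : ℂ) = LocalChar.eps (1 / 125) n (ρ j) psi6) :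
    E3At I v d :=
  E3At_of_complex I v d (fun j => LocalChar.eps (1 / 125) n (ρ j) psi6) he
    (E3_six n ρ hσ hfix a hρ _ kappa_mul_card_six hN2)

end SixModel

end Summit.Ventures.HodgeRepro.PeriodCloser

end
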